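import Mathlib.Analysis.Calculus.LogDeriv
import Mathlib.NumberTheory.LSeries.RiemannZeta
import Literature.NumberTheory.LFunctions.RiemannXi
import HarnessLib

/-!
# Positivity of `Re ξ′/ξ` (Lagarias 1999) — named facts

Trunk T-ANT (Literature/NumberTheory/LFunctions). J. C. Lagarias, *On a positivity property of the
Riemann ξ-function*, Acta Arith. 89 (1999), 217–234 [LagariasXiPositivity1999], records (p. 217):
"This paper starts from the observation that `Re ξ′(s)/ξ(s) > 0` when `Re(s) > 1` (1.4), and that the
Riemann hypothesis is equivalent to the positivity condition `Re ξ′(s)/ξ(s) > 0` when `Re(s) > ½` (1.5).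
These facts are known, and appear in Hinkkanen [4] for example." Both follow from his Thm. 1.1 (for an
admissible zero set `Ω`, all `ρ ∈ Ω` have `Re ρ ≤ θ` iff `Re f_Ω′/f_Ω > 0` on `Re s > θ`) applied to
`ξ(s) = ξ(0) ∏_Ω (1 − s/ρ)` (1.3), together with the Euler-product zero-free region. Thm. 1.2
(specialised to `K = ℚ`, `n_K = 1`, threshold (1.15) `σ ≥ 1 + 9 = 10`): the infimum
`h_ℚ(σ) = inf_t Re ξ′/ξ(σ + it)` is attained on the real axis, `h_ℚ(σ) = ξ′(σ)/ξ(σ)`. Thm. 1.3: under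
RH the same holds for every `σ > ½`.

These are the "local shadow" (`Re ξ′/ξ > 0` ⇔ no left-turning folds of the level lines of `Re ∫ξ`) and
the far-field transversality input of the route
`Summits/RiemannHypothesis/RiemannHypothesis/Theses/NodalHairpin.lean` (items `NodalLadderFar`,
`NodalLadderEuler`, `NodalDictionary`), vendored as named facts:

* `Lagarias1999_re_logDeriv_riemannXi_pos` — (1.4): `Re ξ′/ξ(s) > 0` for `Re s > 1`.
* `Lagarias1999_riemannHypothesis_iff` — (1.5): `RH ⇔ Re ξ′/ξ(s) > 0` for all `Re s > ½`.
* `Lagarias1999_thm12_rat` — Thm. 1.2 for `K = ℚ`: `Re ξ′/ξ(σ + it) ≥ ξ′/ξ(σ)` for `σ ≥ 10`, all real `t`.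
* `Lagarias1999_thm13` — Thm. 1.3: RH ⇒ the same for every `σ > ½`.

Lean reading of `ξ′/ξ`: Mathlib's `logDeriv ξ s = deriv ξ s / ξ s`, which is the junk value `0` at a
zero of `ξ`; so `0 < (logDeriv ξ s).re` at `s` also asserts `ξ s ≠ 0`, exactly as the printed (1.5)
presupposes. In the tree: the partial-fraction expansion behind Thm. 1.1 is PROVED
(`Literature.NumberTheory.LFunctions.IsHadamardSeq.re_logDeriv_riemannXi_eq_tsum`,
`…ZetaLogDerivRePartialFraction.hasSum_zeroOrder_mul_re_inv_sub`, `re_inv_sub_pos`), so (1.4) is within reach of a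
literature-prover; `ξ′/ξ` on `Re s > 1` is `logDeriv_riemannXi_eq_of_one_lt_re`. Deliberately NOT here: Thm. 1.1 in
its abstract form (admissible zero sets), Thm. 1.2 for general number fields `K`, the function-field §4.
Nothing is asserted; users take `(h : <FactName>)`.

## References

* J. C. Lagarias, *On a positivity property of the Riemann ξ-function*, Acta Arith. 89 (1999), no. 3,
  217–234, doi:10.4064/aa-89-3-217-234 — eqs. (1.4), (1.5), Thm. 1.1, Thm. 1.2 with (1.15)–(1.16),
  Thm. 1.3 with (1.18). [LagariasXiPositivity1999]
* A. Hinkkanen, *On functions of bounded type*, Complex Variables 34 (1997), 119–139 (Lagarias's [4]).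
-/

noncomputable section

open Complex

namespace Literature.NumberTheory.LFunctions

/-- NAMED FACT (**Lagarias 1999, eq. (1.4)**, "known … Hinkkanen [4]"; a consequence of Thm. 1.1 and the
Euler product): `Re ξ′(s)/ξ(s) > 0` whenever `Re s > 1`. [cite: LagariasXiPositivity1999, eq. (1.4)] -/
def Lagarias1999_re_logDeriv_riemannXi_pos : Prop :=
  ∀ s : ℂ, 1 < s.re → 0 < (logDeriv riemannXi s).re

/-- NAMED FACT (**Lagarias 1999, eq. (1.5)**, "the Riemann hypothesis is equivalent to the positivity
condition `Re ξ′(s)/ξ(s) > 0` when `Re(s) > ½`"; Thm. 1.1 with `θ = ½`). With Mathlib's `logDeriv`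
(junk value `0` at zeros of `ξ`) the right-hand side also says `ξ ≠ 0` on `Re s > ½`, as the printed
statement presupposes. [cite: LagariasXiPositivity1999, eq. (1.5)] -/
def Lagarias1999_riemannHypothesis_iff : Prop :=
  RiemannHypothesis ↔ ∀ s : ℂ, 1 / 2 < s.re → 0 < (logDeriv riemannXi s).re

/-- NAMED FACT (**Lagarias 1999, Thm. 1.2** for `K = ℚ`: "Let `K` be an algebraic number field of degree
`n_K`. For `σ ≥ 1 + 9/n_K^{1/3}` (1.15) one has `h_K(σ) = ξ_K′(σ)/ξ_K(σ)` (1.16)", where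
`h_K(σ) := inf {Re ξ_K′/ξ_K(σ + it) : −∞ < t < ∞}` (1.14) and `ξ_ℚ = ξ`): for `σ ≥ 10` and every real `t`,
`Re ξ′/ξ(σ + it) ≥ ξ′(σ)/ξ(σ)` (the infimum over the vertical line is attained on the real axis, where
`ξ′/ξ` is real). [cite: LagariasXiPositivity1999, Thm. 1.2] -/
def Lagarias1999_thm12_rat : Prop :=
  ∀ σ : ℝ, 10 ≤ σ → ∀ t : ℝ,
    (logDeriv riemannXi (σ : ℂ)).re ≤ (logDeriv riemannXi ((σ : ℂ) + t * I)).re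

/-- NAMED FACT (**Lagarias 1999, Thm. 1.3**: "If the Riemann hypothesis holds, then
`h_ℚ(σ) = ξ′(σ)/ξ(σ)` for `½ < σ < ∞`" (1.18)): under RH, for every `σ > ½` and real `t`,
`Re ξ′/ξ(σ + it) ≥ ξ′(σ)/ξ(σ)`. [cite: LagariasXiPositivity1999, Thm. 1.3] -/
def Lagarias1999_thm13 : Prop :=
  RiemannHypothesis → ∀ σ : ℝ, 1 / 2 < σ → ∀ t : ℝ,
    (logDeriv riemannXi (σ : ℂ)).re ≤ (logDeriv riemannXi ((σ : ℂ) + t * I)).re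

end Literature.NumberTheory.LFunctions
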